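import Literature.MathematicalPhysics.QuantumLattice.FlowLiebRobinsonProofs
import Mathlib.Analysis.Calculus.MeanValue
import HarnessLib

/-!
# Displacement of a local observable under the flow of a quasi-local generator

Top-down layer (seat B) of the formalisation of the Michalakis–Zwolak stability theorem
(hubbard.S19, `Literature.MathematicalPhysics.QuantumLattice.michalakis_zwolak`): the
elementary half of MZ13 Lemma 2 — "`‖𝓤(r₀; O_u(r)) − O_u(r)‖ ≤ ∫₀ˢ ‖[D(s'), α_{s'}(O_u(r))]‖ ds'
≤ sJ‖O_u(r)‖g(r₀)`" (arXiv:1109.1588 p. 12): for the flow `∂_t U = i H(Ψ_t) U`, `U(0) = 1`, of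
local interactions `Ψ_t` with local norms `Σ_{Z ∋ y} ‖Ψ_t Z‖ ≤ J` on `[0, T]` and `A ∈ 𝔄_X`,
`‖U(t)ᴴ A U(t) − A‖ ≤ t · 2‖A‖ |X| J` (`norm_conj_flow_sub_self_le`): the derivative of
`t ↦ U(t)ᴴ A U(t)` is `U(t)ᴴ [A, iH(Ψ_t)] U(t)` (`hasDerivWithinAt_conj_flow`), only the terms of
`Ψ_t` meeting `X` contribute to the commutator (`norm_comm_localHamiltonian_le`), and the mean
value inequality on `[0, T]` concludes. With `J = |ε| J₀` this is the `O(ε)`-smallness of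
`X⁽²⁾ = U⋆ 𝓕^s(Φ Z) U − 𝓕^s(Φ Z)`. No definitions, no named facts (theorems only).
-/

noncomputable section

open Matrix Complex Set
open scoped Matrix Matrix.Norms.L2Operator

namespace Literature.MathematicalPhysics.QuantumLattice

section Lattice

open Finset

variable {Λ : Type*} [Fintype Λ] [DecidableEq Λ] {q : ℕ}

/-- **Commutator of a local Hamiltonian with a local observable**: for a local interaction `Ψ`
with `Σ_{Z ∋ y} ‖Ψ Z‖ ≤ J` and `A ∈ 𝔄_X`, `‖A H(Ψ) − H(Ψ) A‖ ≤ 2‖A‖ |X| J` (only the terms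
meeting `X` contribute). Nachtergaele–Sims 2006 §3.1. [folklore] -/
theorem norm_comm_localHamiltonian_le {Ψ : Interaction Λ q} (hΨ : Ψ.IsLocal) {X : Finset Λ}
    {A : Op Λ q} (hA : IsSupportedOn A X) {J : ℝ}
    (hJ : ∀ y : Λ, ∑ Z ∈ univ.filter (fun Z : Finset Λ => y ∈ Z), ‖Ψ Z‖ ≤ J) :
    ‖A * localHamiltonian Ψ univ - localHamiltonian Ψ univ * A‖ ≤ 2 * ‖A‖ * (#X * J) := by
  rw [localHamiltonian_univ]
  have hsplit : ∑ Z, Ψ Z = ∑ Z ∈ univ.filter (fun Z : Finset Λ => Disjoint Z X), Ψ Z +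
      ∑ Z ∈ univ.filter (fun Z : Finset Λ => ¬ Disjoint Z X), Ψ Z :=
    (sum_filter_add_sum_filter_not _ _ _).symm
  have hcomm := (hΨ.commute_sum_filter_disjoint hA).eq
  have hred : A * ∑ Z, Ψ Z - (∑ Z, Ψ Z) * A =
      ∑ Z ∈ univ.filter (fun Z : Finset Λ => ¬ Disjoint Z X), (A * Ψ Z - Ψ Z * A) := by
    have h1 : A * ∑ Z, Ψ Z - (∑ Z, Ψ Z) * A =
        A * (∑ Z ∈ univ.filter (fun Z : Finset Λ => ¬ Disjoint Z X), Ψ Z) -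
          (∑ Z ∈ univ.filter (fun Z : Finset Λ => ¬ Disjoint Z X), Ψ Z) * A := by
      rw [hsplit, Matrix.mul_add, Matrix.add_mul, hcomm]
      abel
    rw [h1, Finset.mul_sum, Finset.sum_mul, ← Finset.sum_sub_distrib]
  rw [hred]
  calc ‖∑ Z ∈ univ.filter (fun Z : Finset Λ => ¬ Disjoint Z X), (A * Ψ Z - Ψ Z * A)‖
      ≤ ∑ Z ∈ univ.filter (fun Z : Finset Λ => ¬ Disjoint Z X), ‖A * Ψ Z - Ψ Z * A‖ :=
        norm_sum_le _ _
    _ ≤ ∑ Z ∈ univ.filter (fun Z : Finset Λ => ¬ Disjoint Z X), 2 * ‖A‖ * ‖Ψ Z‖ := by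
        refine sum_le_sum fun Z _ => ?_
        calc ‖A * Ψ Z - Ψ Z * A‖ ≤ ‖A * Ψ Z‖ + ‖Ψ Z * A‖ := norm_sub_le _ _
          _ ≤ ‖A‖ * ‖Ψ Z‖ + ‖Ψ Z‖ * ‖A‖ := add_le_add (norm_mul_le _ _) (norm_mul_le _ _)
          _ = 2 * ‖A‖ * ‖Ψ Z‖ := by ring
    _ = 2 * ‖A‖ * ∑ Z ∈ univ.filter (fun Z : Finset Λ => ¬ Disjoint Z X), ‖Ψ Z‖ := by
        rw [Finset.mul_sum]
    _ ≤ 2 * ‖A‖ * (#X * J) :=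
        mul_le_mul_of_nonneg_left (sum_norm_filter_not_disjoint_le hJ X) (by positivity)

/-- Conjugation by `Uᴴ · U` with `Uᴴ U = U Uᴴ = 1` does not increase the norm. [folklore] -/
theorem norm_conjTranspose_mul_mul_le {U M : Op Λ q} (hU1 : Uᴴ * U = 1) (hU2 : U * Uᴴ = 1) :
    ‖Uᴴ * M * U‖ ≤ ‖M‖ := by
  have hU : U ∈ unitary (Op Λ q) := Unitary.mem_iff.2 ⟨hU1, hU2⟩
  rcases subsingleton_or_nontrivial (Op Λ q) with hs | hs
  · rw [Subsingleton.elim (Uᴴ * M * U) M]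
  · have h1 : ‖U‖ = 1 := CStarRing.norm_of_mem_unitary hU
    have h2 : ‖Uᴴ‖ = 1 := by rw [← star_eq_conjTranspose, norm_star, h1]
    calc ‖Uᴴ * M * U‖ ≤ ‖Uᴴ * M‖ * ‖U‖ := norm_mul_le _ _
      _ ≤ ‖Uᴴ‖ * ‖M‖ * ‖U‖ := by gcongr; exact norm_mul_le _ _
      _ = ‖M‖ := by rw [h1, h2, one_mul, mul_one]

/-- **Displacement of a local observable under the flow (MZ13 Lemma 2, second estimate).** For
the unitary flow `∂_t U = i H(Ψ_t) U`, `U(0) = 1`, of local interactions with local norms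
`Σ_{Z ∋ y} ‖Ψ_t Z‖ ≤ J` on `[0, T]`, and `A ∈ 𝔄_X`, `t ∈ [0, T]`:
`‖U(t)ᴴ A U(t) − A‖ ≤ t · 2‖A‖ |X| J`. [cite: MichalakisZwolakCMP2013, §5.2 Lemma 2 (arXiv:1109.1588 p. 12)] -/
theorem norm_conj_flow_sub_self_le {Ψ : ℝ → Interaction Λ q} (hΨ : ∀ t, (Ψ t).IsLocal)
    {T : ℝ} {U : ℝ → Op Λ q} (hU0 : U 0 = 1)
    (hU : ∀ t ∈ Icc 0 T,
      HasDerivWithinAt U (((I : ℂ) • localHamiltonian (Ψ t) univ) * U t) (Icc 0 T) t)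
    (hU1 : ∀ t ∈ Icc 0 T, (U t)ᴴ * U t = 1) (hU2 : ∀ t ∈ Icc 0 T, U t * (U t)ᴴ = 1)
    {X : Finset Λ} {A : Op Λ q} (hA : IsSupportedOn A X) {J : ℝ}
    (hJ : ∀ t ∈ Icc 0 T, ∀ y : Λ, ∑ Z ∈ univ.filter (fun Z : Finset Λ => y ∈ Z), ‖Ψ t Z‖ ≤ J)
    {t : ℝ} (ht : t ∈ Icc 0 T) :
    ‖(U t)ᴴ * A * U t - A‖ ≤ t * (2 * ‖A‖ * (#X * J)) := by
  set f : ℝ → Op Λ q := fun u => (U u)ᴴ * A * U u with hf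
  set B : ℝ → Op Λ q := fun u => (I : ℂ) • localHamiltonian (Ψ u) univ with hB
  have hBskew : ∀ u, (B u)ᴴ = -B u := fun u => by
    simp only [hB, conjTranspose_smul, (localHamiltonian_isHermitian (hΨ u) univ).eq,
      Complex.star_def, Complex.conj_I, neg_smul]
  have hderiv : ∀ u ∈ Icc 0 T,
      HasDerivWithinAt f ((U u)ᴴ * (A * B u - B u * A) * U u) (Icc 0 T) u := fun u hu =>
    hasDerivWithinAt_conj_flow (hU u hu) (hBskew u) A
  have hbound : ∀ u ∈ Ico 0 T, ‖(U u)ᴴ * (A * B u - B u * A) * U u‖ ≤ 2 * ‖A‖ * (#X * J) := by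
    intro u hu
    have hu' : u ∈ Icc 0 T := Ico_subset_Icc_self hu
    refine (norm_conjTranspose_mul_mul_le (hU1 u hu') (hU2 u hu')).trans ?_
    have hI : A * B u - B u * A = (I : ℂ) • (A * localHamiltonian (Ψ u) univ -
        localHamiltonian (Ψ u) univ * A) := by
      simp only [hB, Matrix.mul_smul, Matrix.smul_mul, smul_sub]
    rw [hI, norm_smul, Complex.norm_I, one_mul]
    exact norm_comm_localHamiltonian_le (hΨ u) hA (hJ u hu')
  have key := norm_image_sub_le_of_norm_deriv_le_segment' hderiv hbound t ht
  have hf0 : f 0 = A := by simp [hf, hU0]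
  rw [hf0, sub_zero] at key
  calc ‖(U t)ᴴ * A * U t - A‖ = ‖f t - A‖ := rfl
    _ ≤ 2 * ‖A‖ * (#X * J) * t := key
    _ = t * (2 * ‖A‖ * (#X * J)) := by ring

end Lattice

end Literature.MathematicalPhysics.QuantumLattice
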